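import Summits.SmoothPoincare4.SmoothPoincare4.Theorems.ConvexBisectionAcyclicBisectionExistsDualHandleSeamModelDual
import Mathlib.Analysis.SpecialFunctions.SmoothTransition
import HarnessLib

/-!
# Dual handles, VIII: the model of the dual handle embedding `𝓕 : D⁴ ∖ S → ℝ⁴`
(brick (iv-a) of the sub-goal T3b "the complement of the prefix sub-handlebody is the other piece
with the DUAL suffix handles" of stub `stub_steinRealisation` (NF6), line `modp-braid-orbits` r11,
crux `ConvexBisection.AcyclicBisectionExists`, item stmt-SmoothPoincare4-10508; wave 2, lead c5)

In the model chart of `…SeamModelChart.lean` / `…SeamModelDual.lean` (Kosinski coordinates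
`x = (x_λ, x_μ)` of the `j`-th handle, extended across the seam; the dual attaching map there is the
explicit `dualVec a κ δ : T → ℝ⁴`) the `j`-th DUAL handle embedding `F_j = D₂.jB j : D⁴ ∖ S → W₂` of
the dual presentation is `Ξ ∘ 𝓕` for ONE explicit map `𝓕 = modelF a κ δ : ℝ⁴ → ℝ⁴` (V5 report §3.1):

    𝓕 z = ( √(𝓅(s)/(1-s)) · z_μ , √(q̃(s,u)) · z_λ ),   s = ‖z_λ‖², u = ‖z_μ‖²/(1-s),

Milnor's exchange of the factors (the `λ`-part of `𝓕 z` is along `z_μ`, the `μ`-part along `z_λ`)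
interpolating, by flat cut-offs `ω = shellCut`, `ω₁ = coreCut` (`Real.smoothTransition`), between
Kosinski's identification `Π ∘ α` near the dual attaching sphere `S = {s = 1}` and a scaled swap near
the dual belt disc `{s = 0}`:

* `pFun κ s = κ² (s + (1 - ω₁ s)/8)` (`= κ² s` for `s ≥ 1/4`, `> 0` on `s ≥ 0`),
  `FTop a κ δ s u = 1 + gProfile a (δ s (1-u)) - κ² s u`,
  `qTilde a κ δ s u = (ω s / s) · FTop + (1 - ω s) · δ` (`ω = 0` on `s ≤ 1/2`, `= 1` on `s ≥ 3/4`;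
  `shellCutDiv s = ω s / s` is smooth), `modelF`;
* `contDiffOn_modelF` — **`𝓕` is `C^∞`** on the open set `modelDom = {s < 1, 0 < qTilde}`, which
  contains `D⁴ ∖ S` (`mem_modelDom_of_mem_closedBall`);
* `modelF_eq_dualVec_handleInversion` — **near `S`, `𝓕 = Π ∘ α` EXACTLY**: for `x ∈ D⁴` with
  `3/4 < ‖x_λ‖² < 1`, `modelF a κ δ x = dualVec a κ δ (α x)` (`α` = Kosinski's `handleInversion`) —
  the clause that lets `E := D₂.jA` be `jN` off the domes (report §3.3);
* `helper_modelF_eq_dualVec` (registered).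

Everything here is proved; no named facts.

## References
* J. Milnor, *Lectures on the h-cobordism theorem* (1965), §3 (dual handles). [MilnorHCobordism1965]
* A. A. Kosinski, *Differential Manifolds* (1993), VI §6, (6.1). [Kosinski1993]
-/

noncomputable section

-- the prescribed namespace `Summit.<P>.<Sub>.…` duplicates `SmoothPoincare4` (P = Sub)
set_option linter.dupNamespace false

open scoped Manifold ContDiff Topology

namespace Summit.SmoothPoincare4.SmoothPoincare4.Theorems.AcyclicBisectionExists.ModpBraidOrbits

open Set Function Metric
open Literature.Topology.FourManifolds Literature.Topology.FourManifolds.HandleAttachingMap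

/-! ### §1 The cut-offs and the scalar profiles -/

section Profiles

/-- The top cut-off `ω s = S(4s - 2)`: `0` for `s ≤ 1/2`, `1` for `s ≥ 3/4`. [folklore] -/
def shellCut (s : ℝ) : ℝ := Real.smoothTransition (4 * s - 2)

/-- The `λ`-cut-off `ω₁ s = S(4s)`: `0` for `s ≤ 0`, `1` for `s ≥ 1/4`. [folklore] -/
def coreCut (s : ℝ) : ℝ := Real.smoothTransition (4 * s)

/-- `ω = 0` on `s ≤ 1/2`. [folklore] -/
theorem shellCut_of_le {s : ℝ} (hs : s ≤ 1 / 2) : shellCut s = 0 :=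
  Real.smoothTransition.zero_of_nonpos (by linarith)

/-- `ω = 1` on `s ≥ 3/4`. [folklore] -/
theorem shellCut_of_ge {s : ℝ} (hs : 3 / 4 ≤ s) : shellCut s = 1 :=
  Real.smoothTransition.one_of_one_le (by linarith)

/-- `ω₁ = 1` on `s ≥ 1/4`. [folklore] -/
theorem coreCut_of_ge {s : ℝ} (hs : 1 / 4 ≤ s) : coreCut s = 1 :=
  Real.smoothTransition.one_of_one_le (by linarith)

/-- `0 ≤ ω ≤ 1`. [folklore] -/
theorem shellCut_mem (s : ℝ) : 0 ≤ shellCut s ∧ shellCut s ≤ 1 :=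
  ⟨Real.smoothTransition.nonneg _, Real.smoothTransition.le_one _⟩

/-- `0 ≤ ω₁ ≤ 1`. [folklore] -/
theorem coreCut_mem (s : ℝ) : 0 ≤ coreCut s ∧ coreCut s ≤ 1 :=
  ⟨Real.smoothTransition.nonneg _, Real.smoothTransition.le_one _⟩

/-- The cut-offs are smooth. [folklore] -/
theorem contDiff_cutTop : ContDiff ℝ ∞ shellCut :=
  Real.smoothTransition.contDiff.comp ((contDiff_const.mul contDiff_id).sub contDiff_const)

/-- The cut-offs are smooth. [folklore] -/
theorem contDiff_cutLam : ContDiff ℝ ∞ coreCut :=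
  Real.smoothTransition.contDiff.comp (contDiff_const.mul contDiff_id)

/-- **`ω s / s` is smooth on `ℝ`** (it vanishes identically near `s ≤ 1/2 ∋ 0`). [folklore] -/
def shellCutDiv (s : ℝ) : ℝ := shellCut s / s

/-- Smoothness of `ω s / s`. [folklore] -/
theorem contDiff_cutTopDiv : ContDiff ℝ ∞ shellCutDiv := by
  rw [contDiff_iff_contDiffAt]
  intro s
  by_cases hs : s < 1 / 2
  · have hev : shellCutDiv =ᶠ[𝓝 s] fun _ => (0 : ℝ) := by
      filter_upwards [Iio_mem_nhds hs] with t ht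
      rw [shellCutDiv, shellCut_of_le (le_of_lt ht), zero_div]
    exact contDiffAt_const.congr_of_eventuallyEq hev
  · have hs0 : s ≠ 0 := by intro h; apply hs; rw [h]; norm_num
    exact (contDiff_cutTop.contDiffAt.div contDiffAt_id hs0)

/-- `ω s / s ≥ 0` for `s ≥ 0`. [folklore] -/
theorem shellCutDiv_nonneg {s : ℝ} (hs : 0 ≤ s) : 0 ≤ shellCutDiv s := div_nonneg (shellCut_mem s).1 hs

/-- **The `λ`-profile `𝓅 κ s = κ² (s + (1 - ω₁ s)/8)`**: `κ² s` for `s ≥ 1/4`, positive on `s ≥ 0`.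
[folklore] -/
def pFun (κ s : ℝ) : ℝ := κ ^ 2 * (s + (1 - coreCut s) / 8)

/-- `𝓅 = κ² s` on `s ≥ 1/4`. [folklore] -/
theorem pFun_of_ge (κ : ℝ) {s : ℝ} (hs : 1 / 4 ≤ s) : pFun κ s = κ ^ 2 * s := by
  rw [pFun, coreCut_of_ge hs]; ring

/-- `𝓅 > 0` on `s ≥ 0` (`κ ≠ 0`). [folklore] -/
theorem pFun_pos {κ : ℝ} (hκ : 0 < κ) {s : ℝ} (hs : 0 ≤ s) : 0 < pFun κ s := by
  unfold pFun
  have h1 := (coreCut_mem s).2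
  rcases eq_or_lt_of_le hs with h0 | h0
  · subst h0
    have : coreCut 0 = 0 := Real.smoothTransition.zero_of_nonpos (by norm_num)
    rw [this]; positivity
  · have : 0 < s + (1 - coreCut s) / 8 := by nlinarith
    positivity

/-- `𝓅` is smooth. [folklore] -/
theorem contDiff_pFun (κ : ℝ) : ContDiff ℝ ∞ (pFun κ) :=
  contDiff_const.mul (contDiff_id.add ((contDiff_const.sub contDiff_cutLam).div_const _))

/-- **The top-shell profile `F = 1 + g a (δ s (1-u)) - κ² s u`** (the squared `μ`-norm of Kosinski's
`Π ∘ α`). [cite: Kosinski1993, VI §6] -/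
def FTop (a κ δ s u : ℝ) : ℝ := 1 + gProfile a (δ * (s * (1 - u))) - κ ^ 2 * (s * u)

/-- **The `μ`-profile `q̃ = (ω s / s) F + (1 - ω s) δ`** (so that `s q̃` blends `F` with `δ s`).
[folklore] -/
def qTilde (a κ δ s u : ℝ) : ℝ := shellCutDiv s * FTop a κ δ s u + (1 - shellCut s) * δ

/-- `q̃ = F / s` on `s ≥ 3/4`. [folklore] -/
theorem qTilde_of_ge (a κ δ : ℝ) {s : ℝ} (hs : 3 / 4 ≤ s) (u : ℝ) :
    qTilde a κ δ s u = FTop a κ δ s u / s := by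
  rw [qTilde, shellCutDiv, shellCut_of_ge hs]; ring

/-- `q̃ = δ` on `s ≤ 1/2`. [folklore] -/
theorem qTilde_of_le (a κ δ : ℝ) {s : ℝ} (hs : s ≤ 1 / 2) (u : ℝ) : qTilde a κ δ s u = δ := by
  rw [qTilde, shellCutDiv, shellCut_of_le hs]; ring

/-- `F > 0` for `0 ≤ s < 1`, `0 ≤ u ≤ 1`, `0 < κ ≤ 1/2`, `0 < δ ≤ 1/2`, `0 < a`. [folklore] -/
theorem FTop_pos {a κ δ s u : ℝ} (ha : 0 < a) (hκ : 0 < κ) (hκ2 : κ ≤ 1 / 2) (hδ : 0 < δ)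
    (hδ2 : δ ≤ 1 / 2) (hs : 0 ≤ s) (hs1 : s < 1) (hu : 0 ≤ u) (hu1 : u ≤ 1) : 0 < FTop a κ δ s u := by
  unfold FTop
  have h1 : 0 ≤ s * (1 - u) := mul_nonneg hs (by linarith)
  have h2 : δ * (s * (1 - u)) < 1 := by
    have : s * (1 - u) ≤ 1 := by nlinarith
    nlinarith
  have hg := gProfile_nonneg ha.le (mul_nonneg hδ.le h1) h2
  have h3 : κ ^ 2 * (s * u) ≤ 1 / 4 := by
    have : s * u ≤ 1 := by nlinarith
    nlinarith [sq_nonneg κ]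
  linarith

/-- `q̃ > 0` under the same hypotheses. [folklore] -/
theorem qTilde_pos {a κ δ s u : ℝ} (ha : 0 < a) (hκ : 0 < κ) (hκ2 : κ ≤ 1 / 2) (hδ : 0 < δ)
    (hδ2 : δ ≤ 1 / 2) (hs : 0 ≤ s) (hs1 : s < 1) (hu : 0 ≤ u) (hu1 : u ≤ 1) : 0 < qTilde a κ δ s u := by
  unfold qTilde
  have hF := FTop_pos ha hκ hκ2 hδ hδ2 hs hs1 hu hu1
  have h1 : 0 ≤ shellCutDiv s * FTop a κ δ s u := mul_nonneg (shellCutDiv_nonneg hs) hF.le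
  rcases lt_or_ge s (3 / 4) with h | h
  · have h2 : shellCut s < 1 := Real.smoothTransition.lt_one_of_lt_one (by linarith)
    nlinarith
  · rw [shellCutDiv, shellCut_of_ge h]
    have hs0 : 0 < s := by linarith
    have : 0 < 1 / s * FTop a κ δ s u := by positivity
    linarith

end Profiles

/-! ### §2 The model map `𝓕` and its smoothness -/

section ModelMap

/-- `s = ‖z_λ‖²`. [folklore] -/
def sOf (z : EuclideanSpace ℝ (Fin 4)) : ℝ := ‖lamPart z‖ ^ 2

/-- `u = ‖z_μ‖² / (1 - s)`. [folklore] -/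
def uOf (z : EuclideanSpace ℝ (Fin 4)) : ℝ := ‖muPart z‖ ^ 2 / (1 - sOf z)

/-- **THE MODEL OF THE DUAL HANDLE EMBEDDING**
`𝓕 z = (√(𝓅(s)/(1-s)) z_μ, √(q̃(s,u)) z_λ)`. [cite: MilnorHCobordism1965, §3] -/
def modelF (a κ δ : ℝ) (z : EuclideanSpace ℝ (Fin 4)) : EuclideanSpace ℝ (Fin 4) :=
  Real.sqrt (pFun κ (sOf z) / (1 - sOf z)) • lamEmbed (muPart z) +
    Real.sqrt (qTilde a κ δ (sOf z) (uOf z)) • muEmbed (lamPart z)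

/-- The domain of smoothness: `s < 1` and `q̃ > 0`. [folklore] -/
def modelDom (a κ δ : ℝ) : Set (EuclideanSpace ℝ (Fin 4)) :=
  {z | sOf z < 1 ∧ 0 < qTilde a κ δ (sOf z) (uOf z)}

/-- `s` is smooth. [folklore] -/
theorem contDiff_sOf : ContDiff ℝ ∞ sOf := (contDiff_norm_sq ℝ).comp contDiff_lamPart

/-- `u` is smooth on `s < 1`. [folklore] -/
theorem contDiffOn_uOf : ContDiffOn ℝ ∞ uOf {z | sOf z < 1} :=
  ContDiffOn.div ((contDiff_norm_sq ℝ).comp contDiff_muPart).contDiffOn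
    (contDiffOn_const.sub contDiff_sOf.contDiffOn) fun z hz => by
      simp only [mem_setOf_eq] at hz; exact sub_ne_zero.2 (ne_of_gt hz)

/-- `g a` is smooth off `t = 1`. [folklore] -/
theorem contDiffOn_gProfile (a : ℝ) : ContDiffOn ℝ ∞ (gProfile a) {t | t < 1} := by
  unfold gProfile
  refine ContDiffOn.div (contDiffOn_const.mul contDiffOn_id)
    (contDiffOn_const.mul (contDiffOn_const.sub contDiffOn_id)) fun t ht => ?_
  simp only [mem_setOf_eq] at ht
  exact mul_ne_zero two_ne_zero (sub_ne_zero.2 (ne_of_gt ht))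

/-- `0 ≤ u` and `δ s (1 - u) < 1` on `0 ≤ s < 1` (`0 < δ ≤ 1/2`). [folklore] -/
theorem uOf_nonneg {z : EuclideanSpace ℝ (Fin 4)} (hz : sOf z < 1) : 0 ≤ uOf z :=
  div_nonneg (sq_nonneg _) (by linarith)

/-- The argument of `g` stays below `1` on `s < 1`. [folklore] -/
theorem arg_lt_one {δ : ℝ} (hδ : 0 < δ) (hδ2 : δ ≤ 1 / 2) {z : EuclideanSpace ℝ (Fin 4)} (hz : sOf z < 1) :
    δ * (sOf z * (1 - uOf z)) < 1 := by
  have h0 : 0 ≤ sOf z := sq_nonneg _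
  have h1 : sOf z * (1 - uOf z) ≤ sOf z := by nlinarith [uOf_nonneg hz]
  nlinarith

/-- **`𝓕` is smooth on `modelDom`.** [folklore] -/
theorem contDiffOn_modelF {a κ δ : ℝ} (hκ : 0 < κ) (hδ : 0 < δ) (hδ2 : δ ≤ 1 / 2) :
    ContDiffOn ℝ ∞ (modelF a κ δ) (modelDom a κ δ) := by
  have hsub : modelDom a κ δ ⊆ {z | sOf z < 1} := fun z hz => hz.1
  -- the scalar `𝓅(s)/(1-s)` and its square root
  have h1 : ContDiffOn ℝ ∞ (fun z => Real.sqrt (pFun κ (sOf z) / (1 - sOf z))) (modelDom a κ δ) := by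
    refine ContDiffOn.sqrt (ContDiffOn.div ((contDiff_pFun κ).comp contDiff_sOf).contDiffOn
      (contDiffOn_const.sub contDiff_sOf.contDiffOn) fun z hz => sub_ne_zero.2 (ne_of_gt hz.1)) fun z hz => ?_
    exact (div_pos (pFun_pos hκ (sq_nonneg _)) (by linarith [hz.1])).ne'
  -- the scalar `q̃(s, u)` and its square root
  have hF : ContDiffOn ℝ ∞ (fun z => FTop a κ δ (sOf z) (uOf z)) {z | sOf z < 1} := by
    unfold FTop
    have harg : ContDiffOn ℝ ∞ (fun z => δ * (sOf z * (1 - uOf z))) {z | sOf z < 1} :=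
      contDiffOn_const.mul (contDiff_sOf.contDiffOn.mul (contDiffOn_const.sub contDiffOn_uOf))
    refine (contDiffOn_const.add ((contDiffOn_gProfile a).comp harg fun z hz => arg_lt_one hδ hδ2 hz)).sub
      (contDiffOn_const.mul (contDiff_sOf.contDiffOn.mul contDiffOn_uOf))
  have h2 : ContDiffOn ℝ ∞ (fun z => Real.sqrt (qTilde a κ δ (sOf z) (uOf z))) (modelDom a κ δ) := by
    refine ContDiffOn.sqrt ?_ fun z hz => hz.2.ne'
    unfold qTilde
    exact (((contDiff_cutTopDiv.comp contDiff_sOf).contDiffOn.mono hsub).mul (hF.mono hsub)).add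
      ((contDiffOn_const.sub ((contDiff_cutTop.comp contDiff_sOf).contDiffOn.mono hsub)).mul contDiffOn_const)
  exact (h1.smul (contDiff_lamEmbed.comp contDiff_muPart).contDiffOn).add
    (h2.smul (contDiff_muEmbed.comp contDiff_lamPart).contDiffOn)

/-- **`D⁴ ∖ S ⊆ modelDom`**: on the closed unit ball with `‖z_λ‖ < 1` one has `u ≤ 1` and `q̃ > 0`.
[folklore] -/
theorem mem_modelDom_of_norm_le_one {a κ δ : ℝ} (ha : 0 < a) (hκ : 0 < κ) (hκ2 : κ ≤ 1 / 2)
    (hδ : 0 < δ) (hδ2 : δ ≤ 1 / 2) {z : EuclideanSpace ℝ (Fin 4)} (hz : ‖z‖ ≤ 1) (hs : sOf z < 1) :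
    z ∈ modelDom a κ δ := by
  refine ⟨hs, qTilde_pos ha hκ hκ2 hδ hδ2 (sq_nonneg _) hs (uOf_nonneg hs) ?_⟩
  rw [uOf, div_le_one (by linarith)]
  have h := norm_sq_eq_lamPart_muPart z
  have h1 : ‖z‖ ^ 2 ≤ 1 := by nlinarith [norm_nonneg z]
  unfold sOf; linarith

/-- The domain of smoothness is open. [folklore] -/
theorem isOpen_modelDom {a κ δ : ℝ} (hκ : 0 < κ) (hδ : 0 < δ) (hδ2 : δ ≤ 1 / 2) : IsOpen (modelDom a κ δ) := by
  have h1 : IsOpen {z : EuclideanSpace ℝ (Fin 4) | sOf z < 1} := isOpen_lt contDiff_sOf.continuous continuous_const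
  have h2 : ContinuousOn (fun z => qTilde a κ δ (sOf z) (uOf z)) {z | sOf z < 1} := by
    have := (contDiffOn_modelF (a := a) hκ hδ hδ2)
    unfold qTilde
    refine ((contDiff_cutTopDiv.comp contDiff_sOf).continuous.continuousOn.mul ?_).add
      ((continuous_const.sub (contDiff_cutTop.comp contDiff_sOf).continuous).continuousOn.mul continuousOn_const)
    unfold FTop
    have hu : ContinuousOn uOf {z | sOf z < 1} := contDiffOn_uOf.continuousOn
    refine (continuousOn_const.add ((contDiffOn_gProfile a).continuousOn.comp
      (continuousOn_const.mul (contDiff_sOf.continuous.continuousOn.mul (continuousOn_const.sub hu)))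
      fun z hz => arg_lt_one hδ hδ2 hz)).sub (continuousOn_const.mul (contDiff_sOf.continuous.continuousOn.mul hu))
  rw [show modelDom a κ δ = {z | sOf z < 1} ∩ (fun z => qTilde a κ δ (sOf z) (uOf z)) ⁻¹' Ioi 0 from rfl]
  exact h2.isOpen_inter_preimage h1 isOpen_Ioi

end ModelMap

/-! ### §3 Near the dual attaching sphere `𝓕` IS Kosinski's identification `Π ∘ α` -/

section Top

/-- The `λ`-part of Kosinski's inversion: `(α x)_λ = (√(1-s)/√s) x_λ`, `s = |x_λ|²`.
[cite: Kosinski1993, VI (6.1)] -/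
theorem lamPart_handleInversion (x : EuclideanSpace ℝ (Fin 4)) :
    lamPart (handleInversion 2 x) =
      (Real.sqrt (1 - lamSq 2 x) / Real.sqrt (lamSq 2 x)) • lamPart x := by
  ext i; fin_cases i <;> simp [lamPart, handleInversion_apply, mul_comm]

/-- The `μ`-part of Kosinski's inversion: `(α x)_μ = (√s/√(1-s)) x_μ`. [cite: Kosinski1993, VI (6.1)] -/
theorem muPart_handleInversion (x : EuclideanSpace ℝ (Fin 4)) :
    muPart (handleInversion 2 x) =
      (Real.sqrt (lamSq 2 x) / Real.sqrt (1 - lamSq 2 x)) • muPart x := by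
  ext i; fin_cases i <;> simp [muPart, handleInversion_apply, mul_comm]

/-- `s = ‖x_λ‖² = lamSq 2 x`. [folklore] -/
theorem sOf_eq_lamSq (x : EuclideanSpace ℝ (Fin 4)) : sOf x = lamSq 2 x := norm_lamPart_sq x

/-- **NEAR `S`, `𝓕 = Π ∘ α` EXACTLY.**  For `x ∈ D⁴` with `3/4 < ‖x_λ‖² < 1`, the model map at `x` is the
dual vector (`…SeamModelDual.lean`: the dual attaching map read in the model chart) at Kosinski's
inverted point `α x ∈ T`: `modelF a κ δ x = dualVec a κ δ (α x)`.  (With `s = ‖x_λ‖²`,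
`u = ‖x_μ‖²/(1-s)`: `(α x)_μ = √(s/(1-s)) x_μ`, `x̂_λ(α x) = x̂_λ`, `1 - ‖α x‖² = s (1 - u)`,
`‖(α x)_μ‖² = s u`, and on `s ≥ 3/4` the cut-offs are `1`: `𝓅 = κ² s`, `q̃ = F/s`.)
[cite: Kosinski1993, VI §6] -/
theorem modelF_eq_dualVec_handleInversion {a κ δ : ℝ} (hκ : 0 < κ) (x : EuclideanSpace ℝ (Fin 4))
    (hx : ‖x‖ ≤ 1) (hs : 3 / 4 < lamSq 2 x) (hs1 : lamSq 2 x < 1) :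
    modelF a κ δ x =
      dualVec a κ δ (handleInversionPt (⟨x, mem_closedBall_zero_iff.2 hx⟩ :
        Metric.closedBall (0 : EuclideanSpace ℝ (Fin 4)) 1) (by show lamSq 2 x ≠ 0; linarith)
        (by show lamSq 2 x ≠ 1; exact ne_of_lt hs1)) := by
  set s := lamSq 2 x with hs_def
  have hs0 : 0 < s := by linarith
  have hs1' : 0 < 1 - s := by linarith
  have hlam : ‖lamPart x‖ = Real.sqrt s := by
    rw [← Real.sqrt_sq (norm_nonneg (lamPart x)), norm_lamPart_sq]
  set y := handleInversionPt (⟨x, mem_closedBall_zero_iff.2 hx⟩ :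
      Metric.closedBall (0 : EuclideanSpace ℝ (Fin 4)) 1) (by show lamSq 2 x ≠ 0; linarith)
      (by show lamSq 2 x ≠ 1; exact ne_of_lt hs1) with hy
  have hyv : tubeVec y = handleInversion 2 x := rfl
  -- the coordinates of `α x`
  have hc : 0 < Real.sqrt (1 - s) / Real.sqrt s := div_pos (Real.sqrt_pos.2 hs1') (Real.sqrt_pos.2 hs0)
  have hc' : 0 ≤ Real.sqrt s / Real.sqrt (1 - s) := (div_pos (Real.sqrt_pos.2 hs0) (Real.sqrt_pos.2 hs1')).le
  have hfib : tubeFibre y = (Real.sqrt s / Real.sqrt (1 - s)) • muPart x := by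
    rw [tubeFibre, hyv, muPart_handleInversion]
  have hang : (tubeAngle y : EuclideanSpace ℝ (Fin 2)) = ‖lamPart x‖⁻¹ • lamPart x := by
    rw [coe_tubeAngle, hyv, lamPart_handleInversion, norm_smul, Real.norm_of_nonneg hc.le, smul_smul,
      mul_inv, mul_assoc, mul_comm (‖lamPart x‖⁻¹), ← mul_assoc, inv_mul_cancel₀ hc.ne', one_mul]
  have hdep : tubeDepth y = s * (1 - uOf x) := by
    rw [tubeDepth, hyv, norm_handleInversion_sq hs0 hs1, uOf, sOf_eq_lamSq, ← hs_def, norm_muPart_sq]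
    field_simp
    ring
  have hfib2 : ‖tubeFibre y‖ ^ 2 = s * uOf x := by
    rw [hfib, norm_smul, mul_pow, Real.norm_of_nonneg hc', div_pow, Real.sq_sqrt hs0.le,
      Real.sq_sqrt hs1'.le, uOf, sOf_eq_lamSq, ← hs_def, norm_muPart_sq]
    field_simp
  have hR : Real.sqrt (1 + gProfile a (δ * tubeDepth y) - κ ^ 2 * ‖tubeFibre y‖ ^ 2) =
      Real.sqrt (FTop a κ δ s (uOf x)) := by
    rw [hdep, hfib2]; rfl
  -- the two profiles on the top shell
  have hs34 : (3 : ℝ) / 4 ≤ sOf x := by rw [sOf_eq_lamSq]; exact hs.le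
  have hs14 : (1 : ℝ) / 4 ≤ sOf x := by linarith
  have hp : Real.sqrt (pFun κ (sOf x) / (1 - sOf x)) = κ * (Real.sqrt s / Real.sqrt (1 - s)) := by
    have : pFun κ (sOf x) / (1 - sOf x) = (κ * (Real.sqrt s / Real.sqrt (1 - s))) ^ 2 := by
      rw [pFun_of_ge κ hs14, sOf_eq_lamSq, ← hs_def, mul_pow, div_pow, Real.sq_sqrt hs0.le,
        Real.sq_sqrt hs1'.le]
      ring
    rw [this, Real.sqrt_sq (mul_nonneg hκ.le hc')]
  have hq : Real.sqrt (qTilde a κ δ (sOf x) (uOf x)) = Real.sqrt (FTop a κ δ s (uOf x)) * ‖lamPart x‖⁻¹ := by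
    rw [qTilde_of_ge a κ δ hs34, sOf_eq_lamSq, ← hs_def, Real.sqrt_div' _ hs0.le, hlam, div_eq_mul_inv]
  rw [modelF, dualVec, hR, hfib, hang, smul_smul, lamEmbed_smul, muEmbed_smul, smul_smul, hp, hq]

/-- **Registered helper `helper_modelF_eq_dualVec` (brick (iv-a) of T3b, sub-goal of NF6
`stub_steinRealisation`, wave 2, lead c5): near the dual attaching sphere the model of the dual handle
embedding IS Kosinski's identification** — `modelF a κ δ x = dualVec a κ δ y` whenever `y ∈ T` is the
inverted point `α x` (`3/4 < ‖x_λ‖² < 1`, `‖x‖ ≤ 1`). [cite: Kosinski1993, VI §6] -/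
theorem helper_modelF_eq_dualVec : ∀ {a κ δ : ℝ}, 0 < κ → ∀ (x : EuclideanSpace ℝ (Fin 4)), ‖x‖ ≤ 1 → 3 / 4 < Literature.Topology.FourManifolds.lamSq 2 x → Literature.Topology.FourManifolds.lamSq 2 x < 1 → ∀ (y : ↥(Literature.Topology.FourManifolds.handleTube 3 2)), Literature.Topology.FourManifolds.tubeVec y = Literature.Topology.FourManifolds.handleInversion 2 x → Summit.SmoothPoincare4.SmoothPoincare4.Theorems.AcyclicBisectionExists.ModpBraidOrbits.modelF a κ δ x = Summit.SmoothPoincare4.SmoothPoincare4.Theorems.AcyclicBisectionExists.ModpBraidOrbits.dualVec a κ δ y := by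
  intro a κ δ hκ x hx hs hs1 y hy
  have : y = handleInversionPt (⟨x, mem_closedBall_zero_iff.2 hx⟩ :
      Metric.closedBall (0 : EuclideanSpace ℝ (Fin 4)) 1) (by show lamSq 2 x ≠ 0; linarith)
      (by show lamSq 2 x ≠ 1; exact ne_of_lt hs1) := Subtype.ext (Subtype.ext hy)
  rw [this]
  exact modelF_eq_dualVec_handleInversion hκ x hx hs hs1

end Top

end Summit.SmoothPoincare4.SmoothPoincare4.Theorems.AcyclicBisectionExists.ModpBraidOrbits

end
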